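import Literature.RingTheory.GaloisAlgebras.ChaseHarrisonRosenberg
import Mathlib.Algebra.Category.ModuleCat.ChangeOfRings
import HarnessLib

/-!
# Galois descent for modules along a free action: `T ⊗_R N ≅ ∏_{x ∈ G} T ⊗_{S,σ_x} M`

research route conditional on HC_CM; not a corollary; Q11.4-sentence-2 already refuted in dim ≥ 3
(Hodge programme context line: this file is pure commutative algebra and is used, via the
Chase–Harrison–Rosenberg charts of an isogeny of abelian varieties, to decompose `g^* g_* F`).

Let a finite group `G` act on the commutative ring `S` by ring automorphisms, let `φ : R → S`
land in (in fact: onto) the invariants, and suppose the action is *free* in the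
Chase–Harrison–Rosenberg sense: there is a dual family `(x_p, y_p)_p` in `S` with
`∑_p x_p y_p = 1` and `∑_p x_p (g • y_p) = 0` for `g ≠ 1`
(`Literature.RingTheory.GaloisAlgebras.exists_finset_sum_mul_smul_of_free`). Let `T` be a
commutative ring with ring maps `f_x : S → T` (`x ∈ G`) of the form `f_x = ι ∘ (x • ·)` for a
fixed `ι = f_1 : S → T`, and `ψ : R → T` with `f_x ∘ φ = ψ`. Then for every `φ`-semilinear
bijection `e : N → M` from an `R`-module `N` to an `S`-module `M` the comparison map
`Φ : T ⊗_{R,ψ} N ⟶ ∏_{x ∈ G} T ⊗_{S,f_x} M`, `t ⊗ n ↦ (t ⊗ e n)_x`,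
is bijective (`galoisProd_bijective`). For `N = M = S` (and `T = S`, `ι = id`) this is the
Chase–Harrison–Rosenberg isomorphism `S ⊗_R S ≅ ∏_G S`; the module version is the descent
statement "`M ↦ S ⊗_R M` is fully faithful / `S ⊗_R M ≅ ⊕_σ M^σ`" of Galois descent
(Greither, LNM 1534, Ch. 0, Thm. 1.6 (i) and the Remark before Lemma 1.10; Knus–Ojanguren,
*Théorie de la descente et algèbres d'Azumaya*, LNM 389, II §5). The explicit inverse is
`(t ⊗_{f_x} m) ↦ ∑_p t·f_x(x_p) ⊗ e⁻¹(y_p m)`.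

Geometric use (Mumford, *Abelian Varieties*, §7, proof of Thm. 4, p. 72, and §23): for a free
quotient `π : X → Y = X/G` by a finite group and a quasi-coherent `F` on `X`, on affine charts
this is `Γ(π^* π_* F) ≅ ∏_g Γ(g^* F)`.

## Main statements

* `Literature.RingTheory.GaloisAlgebras.twistHom`: the `T`-linear comparison map
  `T ⊗_{R,ψ} N ⟶ T ⊗_{S,χ} M`, `t ⊗ n ↦ t ⊗ e n`, for `χ ∘ φ = ψ` and `e` `φ`-semilinear.
* `Literature.RingTheory.GaloisAlgebras.galoisProd`: the map `Φ` into the product over `G`.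
* `Literature.RingTheory.GaloisAlgebras.galoisProd_bijective`: `Φ` is bijective, given a dual
  family, `φ` onto the invariants and `e` bijective.
-/

noncomputable section

set_option backward.isDefEq.respectTransparency false

open CategoryTheory
open scoped TensorProduct ChangeOfRings

universe u

namespace Literature.RingTheory.GaloisAlgebras

variable {R S T : Type u} [CommRing R] [CommRing S] [CommRing T]

/-! ### The comparison map `T ⊗_{R,ψ} N ⟶ T ⊗_{S,χ} M` along a semilinear `e : N → M` -/

section Twist

variable (ψ : R →+* T) (φ : R →+* S) (χ : S →+* T) {N : ModuleCat.{u} R} {M : ModuleCat.{u} S}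

/-- For `t ∈ T`, the additive map `n ↦ t ⊗ e(n) : N → T ⊗_{S,χ} M`. [folklore] -/
def twistAddHom (e : N →ₛₗ[φ] M) (t : T) : N →+ (ModuleCat.extendScalars.{u, u, u} χ).obj M :=
  AddMonoidHom.mk' (fun n => ((t ⊗ₜ[S,χ] e n :) : (ModuleCat.extendScalars.{u, u, u} χ).obj M))
    fun n n' => by
      letI : Module S T := Module.compHom T χ
      change ((t ⊗ₜ[S,χ] e (n + n') :) : (ModuleCat.extendScalars.{u, u, u} χ).obj M) =
        ((t ⊗ₜ[S,χ] e n :) : (ModuleCat.extendScalars.{u, u, u} χ).obj M) +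
          ((t ⊗ₜ[S,χ] e n' :) : (ModuleCat.extendScalars.{u, u, u} χ).obj M)
      rw [map_add, TensorProduct.tmul_add]

/-- `(t, n) ↦ t ⊗ e(n)` as a biadditive map `T × N → T ⊗_{S,χ} M` (with `T` in the form
`T|_ψ`, an `R`-module). [folklore] -/
def twistAddHom₂ (e : N →ₛₗ[φ] M) :
    (ModuleCat.restrictScalars.{u, u, u} ψ).obj (ModuleCat.of T T) →+
      (N →+ (ModuleCat.extendScalars.{u, u, u} χ).obj M) :=
  AddMonoidHom.mk' (fun t => twistAddHom φ χ e (show T from t)) fun t t' => by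
    letI : Module S T := Module.compHom T χ
    ext n
    change (((show T from t) + (show T from t')) ⊗ₜ[S,χ] e n :) =
      ((((show T from t) ⊗ₜ[S,χ] e n :) : (ModuleCat.extendScalars.{u, u, u} χ).obj M) +
        ((show T from t') ⊗ₜ[S,χ] e n :))
    exact TensorProduct.add_tmul _ _ _

/-- The balancing condition `(ψ r · t) ⊗ e n = t ⊗ e (r • n)` (this is `χ ∘ φ = ψ`). [folklore] -/
private theorem twistAddHom₂_smul (hχ : ∀ r, χ (φ r) = ψ r) (e : N →ₛₗ[φ] M) (r : R)
    (t : (ModuleCat.restrictScalars.{u, u, u} ψ).obj (ModuleCat.of T T)) (n : N) :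
    twistAddHom₂ ψ φ χ e (r • t) n = twistAddHom₂ ψ φ χ e t (r • n) := by
  letI : Module S T := Module.compHom T χ
  change (((ψ r * show T from t) ⊗ₜ[S,χ] e n :) : (ModuleCat.extendScalars.{u, u, u} χ).obj M) =
    ((show T from t) ⊗ₜ[S,χ] e (r • n) :)
  rw [LinearMap.map_smulₛₗ, ← TensorProduct.smul_tmul]
  congr 1
  change ψ r * _ = χ (φ r) * _
  rw [hχ]

/-- **The comparison map** `T ⊗_{R,ψ} N ⟶ T ⊗_{S,χ} M`, `t ⊗ n ↦ t ⊗ e(n)`, of `T`-modules,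
for ring maps `ψ : R → T`, `φ : R → S`, `χ : S → T` with `χ ∘ φ = ψ` and a `φ`-semilinear
`e : N → M` (for `e` the identity of `M|_φ` this is the canonical surjection
`T ⊗_R M → T ⊗_S M`). [cite: Greither1992CyclicGalois, Ch. 0, Remark before Lemma 1.10 (p. 5)] -/
def twistHom (hχ : ∀ r, χ (φ r) = ψ r) (e : N →ₛₗ[φ] M) :
    (ModuleCat.extendScalars.{u, u, u} ψ).obj N ⟶ (ModuleCat.extendScalars.{u, u, u} χ).obj M :=
  ModuleCat.ofHom (X := (ModuleCat.extendScalars.{u, u, u} ψ).obj N)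
    (Y := (ModuleCat.extendScalars.{u, u, u} χ).obj M)
  { toFun := fun z => TensorProduct.liftAddHom (twistAddHom₂ ψ φ χ e) (twistAddHom₂_smul ψ φ χ hχ e) z
    map_add' := fun z z' => map_add _ z z'
    map_smul' := fun c z => by
      change _ = c • _
      induction z using TensorProduct.induction_on with
      | zero => rw [smul_zero, map_zero, smul_zero]
      | add z z' hz hz' => rw [smul_add, map_add, hz, hz', map_add, smul_add]
      | tmul t n =>
        change TensorProduct.liftAddHom (twistAddHom₂ ψ φ χ e) (twistAddHom₂_smul ψ φ χ hχ e)
            (c • ((show T from t) ⊗ₜ[R,ψ] n :) : (ModuleCat.extendScalars.{u, u, u} ψ).obj N) =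
          c • ((((show T from t) ⊗ₜ[S,χ] e n :)) : (ModuleCat.extendScalars.{u, u, u} χ).obj M)
        rw [ModuleCat.ExtendScalars.smul_tmul, ModuleCat.ExtendScalars.smul_tmul]
        exact TensorProduct.liftAddHom_tmul _ _ _ _ }

/-- `twistHom` on pure tensors: `t ⊗ n ↦ t ⊗ e(n)`. [cite: Greither1992CyclicGalois, Ch. 0, Remark before Lemma 1.10 (p. 5)] -/
theorem twistHom_tmul (hχ : ∀ r, χ (φ r) = ψ r) (e : N →ₛₗ[φ] M) (t : T) (n : N) :
    twistHom ψ φ χ hχ e ((t ⊗ₜ[R,ψ] n :) : (ModuleCat.extendScalars.{u, u, u} ψ).obj N) =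
      ((t ⊗ₜ[S,χ] e n :) : (ModuleCat.extendScalars.{u, u, u} χ).obj M) :=
  rfl

end Twist

/-! ### The Galois product map `Φ : T ⊗_{R,ψ} N ⟶ ∏_{x ∈ G} T ⊗_{S,f_x} M` -/

section Galois

variable (ψ : R →+* T) (φ : R →+* S) {G : Type u} [Group G] (f : G → (S →+* T))
  (hψ : ∀ x r, f x (φ r) = ψ r) {N : ModuleCat.{u} R} {M : ModuleCat.{u} S} (e : N →ₛₗ[φ] M)

/-- **The Galois product map** `Φ : T ⊗_{R,ψ} N → ∏_{x ∈ G} T ⊗_{S,f_x} M`,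
`t ⊗ n ↦ (t ⊗ e n)_x` (`T`-linear). [cite: Greither1992CyclicGalois, Ch. 0, Thm. 1.6 (i) (pp. 3–4) and Remark before Lemma 1.10 (p. 5)] -/
def galoisProd :
    (ModuleCat.extendScalars.{u, u, u} ψ).obj N →ₗ[T]
      ∀ x : G, (ModuleCat.extendScalars.{u, u, u} (f x)).obj M :=
  LinearMap.pi fun x => (twistHom ψ φ (f x) (hψ x) e).hom

omit [Group G] in
/-- `Φ` on pure tensors: `t ⊗ n ↦ (t ⊗ e n)_x`. [cite: Greither1992CyclicGalois, Ch. 0, Thm. 1.6 (i) (pp. 3–4) and Remark before Lemma 1.10 (p. 5)] -/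
theorem galoisProd_tmul (t : T) (n : N) (x : G) :
    galoisProd ψ φ f hψ e ((t ⊗ₜ[R,ψ] n :) : (ModuleCat.extendScalars.{u, u, u} ψ).obj N) x =
      ((t ⊗ₜ[S,f x] e n :) : (ModuleCat.extendScalars.{u, u, u} (f x)).obj M) :=
  twistHom_tmul ψ φ (f x) (hψ x) e t n

variable [Fintype G] [MulSemiringAction G S]

/-! ### Bijectivity under a dual family (Chase–Harrison–Rosenberg (ii')) -/

section Bijective

variable {ψ φ f e}
variable (hf : ∀ (x : G) (b : S), f x b = f 1 (x • b))
  {s : Finset (S × S)} (hs₁ : ∑ p ∈ s, p.1 * p.2 = 1)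
  (hs : ∀ g : G, g ≠ 1 → ∑ p ∈ s, p.1 * g • p.2 = 0)
  (hinv : ∀ b : S, (∀ g : G, g • b = b) → ∃ r : R, φ r = b)
  (he : Function.Bijective e)

include hinv in
/-- A choice of `R`-preimages of traces: `φ (tr b) = ∑_g g • b` (the trace is invariant,
`smul_sum_smul`, hence in the image of `φ`). [folklore] -/
private theorem exists_traceLift : ∃ tr : S → R, ∀ b : S, φ (tr b) = ∑ g : G, g • b :=
  ⟨fun b => (hinv _ (fun g => smul_sum_smul G g b)).choose,
    fun b => (hinv _ (fun g => smul_sum_smul G g b)).choose_spec⟩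

include hs₁ hs in
/-- **Key identity**: `∑_p x_p · tr(y_p c) = c` for every `c ∈ S` (the dual-basis expansion
`sum_sum_smul_mul_eq_self`). [folklore] -/
private theorem sum_mul_traceLift_eq {tr : S → R} (htr : ∀ b : S, φ (tr b) = ∑ g : G, g • b) (c : S) :
    ∑ p ∈ s, p.1 * φ (tr (p.2 * c)) = c := by
  conv_rhs => rw [← sum_sum_smul_mul_eq_self hs₁ hs c]
  refine Finset.sum_congr rfl fun p _ => ?_
  rw [htr, mul_comm c p.2, mul_comm]

include hs₁ hs in
/-- `∑_p tr(x_p) y_p = 1` (the case `b = 1` of `sum_sum_smul_mul_eq_self'`). [folklore] -/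
private theorem sum_traceLift_mul_eq_one {tr : S → R} (htr : ∀ b : S, φ (tr b) = ∑ g : G, g • b) :
    ∑ p ∈ s, φ (tr p.1) * p.2 = 1 := by
  conv_rhs => rw [← sum_sum_smul_mul_eq_self' hs₁ hs (1 : S)]
  refine Finset.sum_congr rfl fun p _ => ?_
  rw [htr]
  simp only [one_mul]

include he in
/-- The inverse of the bijection `e`, as an additive map `d : M →+ N` with `e ∘ d = id`,
`d ∘ e = id` and `d (φ r • m) = r • d m`. [folklore] -/
private theorem exists_semilinearInverse :
    ∃ d : M →+ N, (∀ m, e (d m) = m) ∧ (∀ n, d (e n) = n) ∧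
      ∀ (r : R) (m : M), d (φ r • m) = r • d m := by
  let E := Equiv.ofBijective e he
  have hE : ∀ m, e (E.symm m) = m := fun m => E.apply_symm_apply m
  refine ⟨AddMonoidHom.mk' E.symm fun a b => he.1 ?_, hE, fun n => E.symm_apply_apply n,
    fun r m => he.1 ?_⟩
  · rw [hE, map_add, hE, hE]
  · change e (E.symm (φ r • m)) = e (r • E.symm m)
    rw [hE, LinearMap.map_smulₛₗ, hE]

include hf in
omit [Fintype G] in
/-- `f_x b = f_z ((z⁻¹ x) • b)`. [folklore] -/
private theorem apply_eq_apply_inv_mul_smul (x z : G) (b : S) : f x b = f z ((z⁻¹ * x) • b) := by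
  rw [hf z, smul_smul, mul_inv_cancel_left, hf x]

include hψ hf in
/-- `∑_x f_x b = ψ (tr b)`. [folklore] -/
private theorem sum_apply_eq {tr : S → R} (htr : ∀ b : S, φ (tr b) = ∑ g : G, g • b) (b : S) :
    ∑ x : G, f x b = ψ (tr b) := by
  rw [← hψ 1, htr, map_sum]
  exact Finset.sum_congr rfl fun x _ => hf x b

include hf hs₁ hs in
omit [Fintype G] in
/-- **Orthogonality on the product side**: `Φ_z (μ_x (t, m)) = δ_{x,z} t ⊗ m`, i.e.
`∑_p (t f_x x_p) ⊗_{f_z} (y_p m) = [x = z] t ⊗ m`. [folklore] -/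
private theorem sum_tmul_smul_eq_ite [DecidableEq G] (x z : G) (t : T) (m : M) :
    ∑ p ∈ s, (((t * f x p.1) ⊗ₜ[S,f z] (p.2 • m) :) :
        (ModuleCat.extendScalars.{u, u, u} (f z)).obj M) =
      if x = z then (t ⊗ₜ[S,f z] m :) else 0 := by
  letI : Module S T := Module.compHom T (f z)
  have step : ∀ p ∈ s, (((t * f x p.1) ⊗ₜ[S,f z] (p.2 • m) :) :
      (ModuleCat.extendScalars.{u, u, u} (f z)).obj M) =
      (t ⊗ₜ[S,f z] ((((z⁻¹ * x) • p.1) * p.2) • m) :) := by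
    intro p _
    rw [apply_eq_apply_inv_mul_smul hf x z p.1, mul_comm t,
      show f z ((z⁻¹ * x) • p.1) * t = ((z⁻¹ * x) • p.1) • t from rfl, TensorProduct.smul_tmul,
      smul_smul]
  rw [Finset.sum_congr rfl step, ← TensorProduct.tmul_sum, ← Finset.sum_smul]
  by_cases hxz : x = z
  · subst hxz
    simp only [inv_mul_cancel, one_smul, hs₁, if_true]
  · have hne : z⁻¹ * x ≠ 1 := fun h => hxz (by
      rw [← mul_inv_cancel_left z x, h, mul_one])
    rw [sum_smul_mul_eq_zero hs (z⁻¹ * x) hne, zero_smul, TensorProduct.tmul_zero, if_neg hxz]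

include hψ hf hs₁ hs in
/-- **Left inverse on pure tensors**: `∑_x μ_x (t, e n) = t ⊗ n`. [folklore] -/
private theorem sum_sum_tmul_eq_tmul {tr : S → R} (htr : ∀ b : S, φ (tr b) = ∑ g : G, g • b)
    {d : M →+ N} (hd : ∀ n, d (e n) = n) (hdφ : ∀ (r : R) (m : M), d (φ r • m) = r • d m)
    (t : T) (n : N) :
    ∑ x : G, ∑ p ∈ s, (((t * f x p.1) ⊗ₜ[R,ψ] d (p.2 • e n) :) :
        (ModuleCat.extendScalars.{u, u, u} ψ).obj N) = (t ⊗ₜ[R,ψ] n :) := by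
  letI : Module R T := Module.compHom T ψ
  rw [Finset.sum_comm]
  have step : ∀ p ∈ s, ∑ x : G, (((t * f x p.1) ⊗ₜ[R,ψ] d (p.2 • e n) :) :
      (ModuleCat.extendScalars.{u, u, u} ψ).obj N) =
      (t ⊗ₜ[R,ψ] d ((φ (tr p.1) * p.2) • e n) :) := by
    intro p _
    rw [← TensorProduct.sum_tmul, ← Finset.mul_sum, sum_apply_eq hψ hf htr, mul_smul, hdφ,
      ← TensorProduct.smul_tmul]
    congr 1
    change t * ψ _ = ψ _ * t
    rw [mul_comm]
  rw [Finset.sum_congr rfl step, ← TensorProduct.tmul_sum]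
  congr 1
  rw [← map_sum, ← Finset.sum_smul, sum_traceLift_mul_eq_one hs₁ hs htr, one_smul, hd]

include hψ hs₁ hs in
/-- **`S`-balancedness of `μ_x`**: `μ_x (t, b • m) = ∑_p (f_x b · t · f_x x_p) ⊗ e⁻¹ (y_p m)`.
[folklore] -/
private theorem sum_tmul_smul_smul_eq {tr : S → R} (htr : ∀ b : S, φ (tr b) = ∑ g : G, g • b)
    {d : M →+ N} (hdφ : ∀ (r : R) (m : M), d (φ r • m) = r • d m)
    (x : G) (t : T) (b : S) (m : M) :
    ∑ p ∈ s, (((t * f x p.1) ⊗ₜ[R,ψ] d (p.2 • b • m) :) :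
        (ModuleCat.extendScalars.{u, u, u} ψ).obj N) =
      ∑ p ∈ s, ((f x b * t * f x p.1) ⊗ₜ[R,ψ] d (p.2 • m) :) := by
  letI : Module R T := Module.compHom T ψ
  -- expand `y_p b = ∑_q tr(y_p b x_q) y_q`
  have step : ∀ p ∈ s, (((t * f x p.1) ⊗ₜ[R,ψ] d (p.2 • b • m) :) :
      (ModuleCat.extendScalars.{u, u, u} ψ).obj N) =
      ∑ q ∈ s, ((t * f x p.1 * ψ (tr (p.2 * b * q.1))) ⊗ₜ[R,ψ] d (q.2 • m) :) := by
    intro p _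
    conv_lhs => rw [smul_smul, ← sum_sum_smul_mul_eq_self' hs₁ hs (p.2 * b)]
    rw [Finset.sum_smul, map_sum, TensorProduct.tmul_sum]
    refine Finset.sum_congr rfl fun q _ => ?_
    rw [← htr (p.2 * b * q.1), mul_smul (φ (tr (p.2 * b * q.1))) q.2 m, hdφ,
      ← TensorProduct.smul_tmul]
    congr 1
    change ψ _ * _ = _
    rw [mul_comm]
  rw [Finset.sum_congr rfl step, Finset.sum_comm]
  refine Finset.sum_congr rfl fun q _ => ?_
  rw [← TensorProduct.sum_tmul]
  congr 1
  have key := sum_mul_traceLift_eq hs₁ hs htr (b * q.1)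
  calc ∑ p ∈ s, t * f x p.1 * ψ (tr (p.2 * b * q.1))
      = t * f x (∑ p ∈ s, p.1 * φ (tr (p.2 * (b * q.1)))) := by
        rw [map_sum, Finset.mul_sum]
        refine Finset.sum_congr rfl fun p _ => ?_
        rw [map_mul, hψ, mul_assoc p.2, mul_assoc]
    _ = f x b * t * f x q.1 := by rw [key, map_mul]; ring

include hf hs₁ hs hinv he in
/-- **Galois descent for modules along a free action** (Chase–Harrison–Rosenberg (ii') for
modules; Greither, LNM 1534, Ch. 0, Thm. 1.6 (i) and Remark before Lemma 1.10; Knus–Ojanguren,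
LNM 389, II.5; Mumford, *Abelian Varieties*, §7, p. 72): given a dual family `(x_p, y_p)`,
`φ : R → S` reaching all invariants, ring maps `f_x = f_1 ∘ (x • ·) : S → T` with
`f_x ∘ φ = ψ`, and a `φ`-semilinear bijection `e : N → M`, the map
`Φ : T ⊗_{R,ψ} N → ∏_x T ⊗_{S,f_x} M`, `t ⊗ n ↦ (t ⊗ e n)_x`, is bijective, with inverse
`(t_x ⊗_{f_x} m_x)_x ↦ ∑_x ∑_p t_x f_x(x_p) ⊗ e⁻¹(y_p m_x)`. [cite: Greither1992CyclicGalois, Ch. 0, Thm. 1.6 (i) (pp. 3–4) and Remark before Lemma 1.10 (p. 5)] -/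
theorem galoisProd_bijective : Function.Bijective (galoisProd ψ φ f hψ e) := by
  classical
  obtain ⟨tr, htr⟩ := exists_traceLift (G := G) (φ := φ) hinv
  obtain ⟨d, hed, hd, hdφ⟩ := exists_semilinearInverse (e := e) he
  letI : Module R T := Module.compHom T ψ
  let Q : ModuleCat.{u} T := (ModuleCat.extendScalars.{u, u, u} ψ).obj N
  have hsmulQ : ∀ (c t : T) (n : N), c • (((t ⊗ₜ[R,ψ] n :)) : Q) = ((c * t) ⊗ₜ[R,ψ] n :) :=
    fun c t n => ModuleCat.ExtendScalars.smul_tmul (f := ψ) (M := N) c t n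
  -- the inverse on the `x`-th factor: `μ_x (t, m) = ∑_p (t f_x x_p) ⊗ d (y_p m)`, biadditive and
  -- `S`-balanced, hence a map `Ψ_x : T ⊗_{S,f_x} M → Q`
  let μ : ∀ x : G, (ModuleCat.restrictScalars.{u, u, u} (f x)).obj (ModuleCat.of T T) →+
      ((M : Type u) →+ (Q : Type u)) := fun x =>
    letI : Module S T := Module.compHom T (f x)
    AddMonoidHom.mk' (fun t => AddMonoidHom.mk'
      (fun m => ∑ p ∈ s, ((((show T from t) * f x p.1) ⊗ₜ[R,ψ] d (p.2 • m) :) : Q))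
      (fun m m' => by
        change ∑ p ∈ s, ((((show T from t) * f x p.1) ⊗ₜ[R,ψ] d (p.2 • (m + m')) :) : Q) = _
        rw [← Finset.sum_add_distrib]
        refine Finset.sum_congr rfl fun p _ => ?_
        rw [smul_add, map_add, TensorProduct.tmul_add]))
      (fun t t' => by
        ext m
        change ∑ p ∈ s, ((((show T from t) + (show T from t')) * f x p.1) ⊗ₜ[R,ψ] d (p.2 • m) :) =
          ∑ p ∈ s, ((((show T from t) * f x p.1) ⊗ₜ[R,ψ] d (p.2 • m) :) : Q) +
            ∑ p ∈ s, ((((show T from t') * f x p.1) ⊗ₜ[R,ψ] d (p.2 • m) :) : Q)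
        rw [← Finset.sum_add_distrib]
        refine Finset.sum_congr rfl fun p _ => ?_
        rw [add_mul, TensorProduct.add_tmul])
  have hμ : ∀ (x : G) (t : (ModuleCat.restrictScalars.{u, u, u} (f x)).obj (ModuleCat.of T T))
      (m : M), μ x t m =
        ∑ p ∈ s, ((((show T from t) * f x p.1) ⊗ₜ[R,ψ] d (p.2 • m) :) : Q) :=
    fun _ _ _ => rfl
  have hμbal : ∀ (x : G) (b : S)
      (t : (ModuleCat.restrictScalars.{u, u, u} (f x)).obj (ModuleCat.of T T)) (m : M),
      μ x (b • t) m = μ x t (b • m) := by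
    intro x b t m
    rw [hμ, hμ, sum_tmul_smul_smul_eq hψ hs₁ hs htr hdφ x (show T from t) b m]
    rfl
  let Ψx : ∀ x : G, ((ModuleCat.extendScalars.{u, u, u} (f x)).obj M : Type u) →+ (Q : Type u) :=
    fun x => TensorProduct.liftAddHom (μ x) (hμbal x)
  have hΨx : ∀ (x : G) (t : T) (m : M),
      Ψx x ((t ⊗ₜ[S,f x] m :) : (ModuleCat.extendScalars.{u, u, u} (f x)).obj M) =
        ∑ p ∈ s, (((t * f x p.1) ⊗ₜ[R,ψ] d (p.2 • m) :) : Q) :=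
    fun x t m => rfl
  let Ψ : (∀ x : G, ((ModuleCat.extendScalars.{u, u, u} (f x)).obj M : Type u)) → (Q : Type u) :=
    fun c => ∑ x, Ψx x (c x)
  -- `Φ ∘ Ψ_x = single x`
  have hΦΨx : ∀ (x : G) (w : (ModuleCat.extendScalars.{u, u, u} (f x)).obj M),
      galoisProd ψ φ f hψ e (Ψx x w) = Pi.single x w := by
    intro x w
    induction w using TensorProduct.induction_on with
    | zero => rw [map_zero, map_zero, Pi.single_zero]
    | add w w' hw hw' => rw [map_add, map_add, hw, hw', Pi.single_add]
    | tmul t m =>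
      change galoisProd ψ φ f hψ e (Ψx x (((show T from t) ⊗ₜ[S,f x] m :) :
          (ModuleCat.extendScalars.{u, u, u} (f x)).obj M)) =
        Pi.single x ((((show T from t) ⊗ₜ[S,f x] m :)) : (ModuleCat.extendScalars.{u, u, u} (f x)).obj M)
      funext z
      rw [hΨx, map_sum, Finset.sum_apply]
      simp only [galoisProd_tmul, hed]
      rw [sum_tmul_smul_eq_ite hf hs₁ hs x z (show T from t) m]
      by_cases hxz : x = z
      · subst hxz; rw [if_pos rfl, Pi.single_eq_same]
      · rw [if_neg hxz, Pi.single_eq_of_ne' hxz]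
  refine Function.bijective_iff_has_inverse.2 ⟨Ψ, fun z => ?_, fun c => ?_⟩
  · -- left inverse
    change ∑ x, Ψx x (galoisProd ψ φ f hψ e z x) = z
    induction z using TensorProduct.induction_on with
    | zero => simp only [map_zero, Pi.zero_apply, Finset.sum_const_zero]
    | add z z' hz hz' =>
      conv_rhs => rw [← hz, ← hz']
      rw [← Finset.sum_add_distrib]
      refine Finset.sum_congr rfl fun x _ => ?_
      rw [map_add, Pi.add_apply, map_add]
    | tmul t n =>
      change ∑ x, Ψx x (galoisProd ψ φ f hψ e (((show T from t) ⊗ₜ[R,ψ] n :) : Q) x) =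
        (((show T from t) ⊗ₜ[R,ψ] n :) : Q)
      simp only [galoisProd_tmul, hΨx]
      exact sum_sum_tmul_eq_tmul hψ hf hs₁ hs htr hd hdφ (show T from t) n
  · -- right inverse
    change galoisProd ψ φ f hψ e (∑ x, Ψx x (c x)) = c
    rw [map_sum]
    simp only [hΦΨx]
    exact Finset.univ_sum_single c

end Bijective

/-! ### The free-action form -/

/-- **Galois descent for modules along a free action**, Chase–Harrison–Rosenberg form: if the
finite group `G` acts on `S` *freely* (`∑_b S (g • b - b) = S` for `g ≠ 1`), `φ : R → S`
reaches all invariants, `f_x = f_1 ∘ (x • ·)` and `f_x ∘ φ = ψ`, then for every `φ`-semilinear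
bijection `e : N → M` the Galois product map `T ⊗_{R,ψ} N → ∏_x T ⊗_{S,f_x} M` is bijective
(`exists_finset_sum_mul_smul_of_free` + `galoisProd_bijective`). [cite: Greither1992CyclicGalois, Ch. 0, Thm. 1.6 (i) (pp. 3–4) and Remark before Lemma 1.10 (p. 5)] -/
theorem galoisProd_bijective_of_free
    (hfree : ∀ g : G, g ≠ 1 → Ideal.span (Set.range fun b : S => g • b - b) = ⊤)
    (hf : ∀ (x : G) (b : S), f x b = f 1 (x • b))
    (hinv : ∀ b : S, (∀ g : G, g • b = b) → ∃ r : R, φ r = b)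
    (he : Function.Bijective e) :
    Function.Bijective (galoisProd ψ φ f hψ e) := by
  obtain ⟨s, hs₁, hs⟩ := exists_finset_sum_mul_smul_of_free ℤ G hfree
  exact galoisProd_bijective hψ hf hs₁ hs hinv he

end Galois

end Literature.RingTheory.GaloisAlgebras
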